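import Summits.BirchSwinnertonDyer.Rank1Residual.X10.UnitRoad
import Summits.BirchSwinnertonDyer.Rank1Residual.Partition.MainConjectures
import Summits.BirchSwinnertonDyer.Rank1Residual.Additive.IntModelTamagawaCertificate
import HarnessLib

/-!
# Class X10b (N2), the UNIT and TRIVIAL-PARTNER roads at `p = 3`, part II: `BSD(E,3)` AT THE PAIR from
# the road's main conjecture, and the Tamagawa binder of the four partner curves IN THE KERNEL
# (cell `b2b-bsdres`, unit `b2b-bsdres-x10` = N2 class lead, gen 25)

HONEST FRAMING (run/shared/lean/b2b/bsd-rank1-residual/, verbatim in every file): the goal of the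
cell is to DELETE the COMBINATION-SHAPED residual classes of the Birch–Swinnerton-Dyer formula for
ALL analytic-rank `≤ 1` elliptic curves over `ℚ` — "full BSD formula for every rank `≤ 1` curve in
class `C`" assembled STRICTLY from published theorems — so that the rank-`≤ 1` remainder becomes
exactly the CONSTRUCTION-SHAPED classes, which are TYPED (missing-input `Prop`s), NOT attempted.
This is not "finishing BSD". Theorems only; NO definition, NO named fact is introduced; class X10b
(`p = 3` good ordinary, `E[3]` irreducible, `ρ̄_{E,3}` onto a Cartan normaliser) keeps its label
CONSTRUCTION-SHAPED (NEEDS X_A3 = `MazurMainConjecture W 3`); nothing is booked by this file;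
everything is PER PAIR.

## What this file adds (composition of landed theorems; x10 gen 25)

Gen 24 (`X10/UnitRoad.lean`) instantiated Mazur's main conjecture WITH `μ = 0` at `(E,3)` for the 77
UNIT cells of N2 (trivial `3`-primary arithmetic: x9 gen 5's
`mazurMainConjecture_with_mu_zero_of_trivialArithmetic_odd`) and for the 18 NON-unit cells congruent
mod `3` to a unit curve (`338d1`, `6845b1`, `13225a1`, `256d1`; Greenberg–Vatsal 2000 Thm. (1.4)) —
X_A3 AT THE PAIR, the MAIN CONJECTURE recorded, not `BSD(E,3)`. All 18 partner-road cells have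
`9 ∣ ∏ c_ℓ(E)` (census: `∏ c_ℓ ∈ {18, 36, 54, 108, 162, 216, 324, 360}`, `#Ш_an = 1`; 11 of analytic
rank `0`, 7 of analytic rank `1`). This file composes the road with the cell's universal skeletons
`Rank1Residual.bsdp_of_mazurMainConjecture_of_analyticRank_eq_zero` (Greenberg LNM 1716 Thm. 4.1 via
Castella–Grossi–Lee–Skinner's deduction `Wuthrich2014.missingPPartAt_of_mainConjecture`) and
`…_of_analyticRank_eq_one_of_schneider_odd` (Perrin-Riou–Schneider leading terms at an odd prime +
Perrin-Riou's `p`-adic Gross–Zagier + the Mazur–Tate `σ`-function, MODULO the per-curve Schneider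
certificate `hSch`), file `Partition/MainConjectures.lean`:

* §0 `tamagawaProduct_p338d1 / _p6845b1 / _p13225a1 / _p256d1` — `∏ c_ℓ(A) = 2, 4, 4, 2` IN THE
  KERNEL for the four partner curves (Tate's algorithm as the rank-2 observatory's `decide`-able row
  certificates `TamZ.rowCheckZ`, bridge `IntModelTam.tamagawaProduct_eq_rowValueZ_of_intModel`):
  the partner binder `htamA : ¬ 3 ∣ ∏ c_ℓ(A)` of every partner-road record is discharged
  (`not_three_dvd_tamagawaProduct_p…`).
* §1 `bsdp_three_of_ainvs_of_trivialArithmetic` — UNIT road ⇒ `BSDp W 3` (analytic rank `0`).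
* §2 `bsdp_three_of_ainvs_of_trivialPartner_rankZero` — TRIVIAL-PARTNER road ⇒ `BSDp W 3` for a
  target of analytic rank `0`: NO descent, NO `L`-value, NO Tamagawa datum OF THE TARGET enters —
  Greenberg's Euler characteristic carries `Ш(E)[3^∞]` and `∏ c_ℓ(E)` together (the K-CM road's
  mechanism, x9 gen 4, now from a unit partner instead of Rubin's CM main conjecture).
* §2 `bsdp_three_of_ainvs_of_trivialPartner_rankOne_of_schneider` — the same for a target of
  analytic rank `1`, MODULO the Schneider certificate of the canonical `3`-adic height (`hSch`).
Displayed binders of the consumers: PUBLISHED `hkato` (Kato 2004 Thm. 17.4 (1)), `hGr`, `h5`, `h3`,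
`hGV`, `hmod`, `hGZK` (+ `hS`, `hPR`, `hMT` in rank one); census `htam[A]`, `hL[A]`, `hSel[A]`;
`hr0` / `hr1` (analytic rank of the target); `hSch` (rank one). The per-pair records are the sibling
files `X10/UnitRoadPartnerBSDRecords*.lean`. Per pair; no class statement; nothing booked; N2 mark
unchanged.

References: K. Kato, Astérisque 295 (2004) Thm. 17.4 (1) [Kato2004Asterisque]; R. Greenberg, LNM
1716 (1999) Thm. 4.1 [GreenbergLNM1716]; R. Greenberg, V. Vatsal, Invent. Math. 142 (2000) Thm.
(1.4) [GreenbergVatsal2000]; F. Castella, G. Grossi, J. Lee, C. Skinner, Invent. Math. 227 (2022)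
Thm. 5.1.4 [CastellaEtAl2021]; B. Perrin-Riou, Invent. Math. 89 (1987) §1.4 Cor. 1.8
[PerrinRiou1987]; J. Balakrishnan, J. S. Müller, W. Stein, Math. Comp. 85 (2016) Thm. 1.7
[BalakrishnanMullerStein2015]; B. Mazur, J. Tate, Duke Math. J. 62 (1991) Thm. 3.1 [MazurTate1991];
R. L. Miller, LMS J. Comput. Math. 14 (2011) Def. 1.1 [Miller2011LMS]; J. Tate, LNM 476 (1975) §7
[Tate1975]; J. H. Silverman, GTM 151 (1994) IV.9.4 [Silverman1994]; J. E. Cremona, *Algorithms for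
Modular Elliptic Curves* (tables) [Cremona2006]; cell file X10-AUDIT.md §31.
-/

set_option autoImplicit false

noncomputable section

open scoped Classical MatrixGroups ModularForm

open CongruenceSubgroup WeierstrassCurve Literature.NumberTheory.EllipticCurves
  Literature.NumberTheory.EllipticCurves.ModularForms Literature.NumberTheory.EllipticCurves.Rank1Residual
  Literature.NumberTheory.EllipticCurves.Rank1Residual.X11RankOneCertificates
  Summit.BirchSwinnertonDyer.BirchSwinnertonDyer.Rank1Residual.IntModel
  Summit.BirchSwinnertonDyer.BirchSwinnertonDyer.Rank1Residual.X11RankOne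
  Summit.BirchSwinnertonDyer.BirchSwinnertonDyer.Theorems.Rank1ResidualX1Defs
  Summit.BirchSwinnertonDyer.BirchSwinnertonDyer.Rank2Observatory.Tam
  Summit.BirchSwinnertonDyer.Rank1Residual.Additive

namespace Summit.BirchSwinnertonDyer.Rank1Residual.X10.UnitRoad

/-! ### §0. The Tamagawa product of the four unit partners, IN THE KERNEL (Tate's algorithm) -/

/-- Row certificate of `338d1 = [1, 1, 0, 504, -13112]` (`Δ = −2³·13⁹`): `2` of type `I₃` NON-split
(`c₂ = 1`), `13` of type `III*` (`c₁₃ = 2`); stage-1 exact, `∏ c_ℓ = 2` (Cremona: `2`). Engine = the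
rank-2 observatory's `tam.py` via n1011-p03's `tamcert.py`, unchanged; the kernel re-verifies the row.
[cite: Silverman1994, IV.9.4] [cite: Cremona2006, Table 1 (Cremona label 338d1)] -/
theorem rowCheckZ_p338d1 :
    TamZ.rowCheckZ [⟨2, 1, 2, 0, 0, 0, 0, 3, 0, 0, 1⟩, ⟨13, 3, 5, 0, 70, 6, 2162, 9, 9, 0, 2⟩] [] []
      ⟨1, 1, 0, 504, -13112⟩ = true := by
  decide +kernel

/-- **`∏_ℓ c_ℓ (338d1) = 2` IN THE KERNEL** for any globally minimal `A / ℚ` with integral model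
`[1, 1, 0, 504, -13112]`. [cite: Tate1975, §7] [cite: Silverman1994, IV.9.4] [cite: Cremona2006, Table 1 (Cremona label 338d1)] -/
theorem tamagawaProduct_p338d1 {A : WeierstrassCurve ℚ} [A.IsGloballyMinimal]
    (hA : integralModelInt A = ⟨1, 1, 0, 504, -13112⟩) : A.tamagawaProduct = 2 :=
  (IntModelTam.tamagawaProduct_eq_rowValueZ_of_intModel hA rowCheckZ_p338d1 (by decide +kernel)).trans
    (by decide +kernel)

/-- Hence `3 ∤ ∏_ℓ c_ℓ (338d1)`: the partner binder `htamA` of the `338d1`-records discharged.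
[cite: Silverman1994, IV.9.4] [cite: Cremona2006, Table 1 (Cremona label 338d1)] -/
theorem not_three_dvd_tamagawaProduct_p338d1 {A : WeierstrassCurve ℚ} [A.IsGloballyMinimal]
    (hA : integralModelInt A = ⟨1, 1, 0, 504, -13112⟩) : ¬ 3 ∣ A.tamagawaProduct := by
  rw [tamagawaProduct_p338d1 hA]; decide

/-- Row certificate of `6845b1 = [0, -1, 1, -472761, 104815596]` (`Δ = 5⁶·37⁹`): `5` of type `I₆`
NON-split (`c₅ = 2`), `37` of type `III*` (`c₃₇ = 2`); stage-1 exact, `∏ c_ℓ = 4` (Cremona: `4`).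
[cite: Silverman1994, IV.9.4] [cite: Cremona2006, Table 1 (Cremona label 6845b1)] -/
theorem rowCheckZ_p6845b1 :
    TamZ.rowCheckZ [⟨5, 2, 3, 0, 0, 0, 0, 6, 0, 0, 2⟩, ⟨37, 6, 5, 0, 913, 0, 25326, 9, 9, 0, 2⟩] [] []
      ⟨0, -1, 1, -472761, 104815596⟩ = true := by
  decide +kernel

/-- **`∏_ℓ c_ℓ (6845b1) = 4` IN THE KERNEL** for any globally minimal `A / ℚ` with integral model
`[0, -1, 1, -472761, 104815596]`. [cite: Tate1975, §7] [cite: Silverman1994, IV.9.4] [cite: Cremona2006, Table 1 (Cremona label 6845b1)] -/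
theorem tamagawaProduct_p6845b1 {A : WeierstrassCurve ℚ} [A.IsGloballyMinimal]
    (hA : integralModelInt A = ⟨0, -1, 1, -472761, 104815596⟩) : A.tamagawaProduct = 4 :=
  (IntModelTam.tamagawaProduct_eq_rowValueZ_of_intModel hA rowCheckZ_p6845b1 (by decide +kernel)).trans
    (by decide +kernel)

/-- Hence `3 ∤ ∏_ℓ c_ℓ (6845b1)`. [cite: Silverman1994, IV.9.4] [cite: Cremona2006, Table 1 (Cremona label 6845b1)] -/
theorem not_three_dvd_tamagawaProduct_p6845b1 {A : WeierstrassCurve ℚ} [A.IsGloballyMinimal]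
    (hA : integralModelInt A = ⟨0, -1, 1, -472761, 104815596⟩) : ¬ 3 ∣ A.tamagawaProduct := by
  rw [tamagawaProduct_p6845b1 hA]; decide

/-- Row certificate of `13225a1 = [0, -1, 1, -383, -7832]` (`Δ = −5⁹·23³`): `5` of type `I₃*` with the
kernel-sharpened certificate `TamZ` (Tate's quadratic has NO residue root: `c₅ = 2`), `23` of type `III`
(`c₂₃ = 2`); stage-3 exact, `∏ c_ℓ = 4` (Cremona: `4`).
[cite: Tate1975, §7] [cite: Silverman1994, IV.9.4 Steps 6–7] [cite: Cremona2006, Table 1 (Cremona label 13225a1)] -/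
theorem rowCheckZ_p13225a1 :
    TamZ.rowCheckZ [⟨5, 2, 5, 0, 102, 0, 62, 9, 71, 1, 2⟩, ⟨23, 4, 4, 0, 8, 0, 11, 3, 3, 2, 2⟩] []
      [⟨5, 6, 102, 0, 62, 9, 1, 0⟩] ⟨0, -1, 1, -383, -7832⟩ = true := by
  decide +kernel

/-- **`∏_ℓ c_ℓ (13225a1) = 4` IN THE KERNEL** for any globally minimal `A / ℚ` with integral model
`[0, -1, 1, -383, -7832]`. [cite: Tate1975, §7] [cite: Silverman1994, IV.9.4 Steps 6–7] [cite: Cremona2006, Table 1 (Cremona label 13225a1)] -/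
theorem tamagawaProduct_p13225a1 {A : WeierstrassCurve ℚ} [A.IsGloballyMinimal]
    (hA : integralModelInt A = ⟨0, -1, 1, -383, -7832⟩) : A.tamagawaProduct = 4 :=
  (IntModelTam.tamagawaProduct_eq_rowValueZ_of_intModel hA rowCheckZ_p13225a1 (by decide +kernel)).trans
    (by decide +kernel)

/-- Hence `3 ∤ ∏_ℓ c_ℓ (13225a1)`. [cite: Silverman1994, IV.9.4] [cite: Cremona2006, Table 1 (Cremona label 13225a1)] -/
theorem not_three_dvd_tamagawaProduct_p13225a1 {A : WeierstrassCurve ℚ} [A.IsGloballyMinimal]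
    (hA : integralModelInt A = ⟨0, -1, 1, -383, -7832⟩) : ¬ 3 ∣ A.tamagawaProduct := by
  rw [tamagawaProduct_p13225a1 hA]; decide

/-- Row certificate of `256d1 = [0, -1, 0, -3, -1]` (`Δ = 2⁹`; CM by `ℤ[√−2]`): `2` of type `III`
(`c₂ = 2`); stage-1 exact, `∏ c_ℓ = 2` (Cremona: `2`).
[cite: Silverman1994, IV.9.4] [cite: Cremona2006, Table 1 (Cremona label 256d1)] -/
theorem rowCheckZ_p256d1 :
    TamZ.rowCheckZ [⟨2, 1, 4, 0, 1, 0, 0, 9, 3, 2, 2⟩] [] [] ⟨0, -1, 0, -3, -1⟩ = true := by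
  decide +kernel

/-- **`∏_ℓ c_ℓ (256d1) = 2` IN THE KERNEL** for any globally minimal `A / ℚ` with integral model
`[0, -1, 0, -3, -1]`. [cite: Tate1975, §7] [cite: Silverman1994, IV.9.4] [cite: Cremona2006, Table 1 (Cremona label 256d1)] -/
theorem tamagawaProduct_p256d1 {A : WeierstrassCurve ℚ} [A.IsGloballyMinimal]
    (hA : integralModelInt A = ⟨0, -1, 0, -3, -1⟩) : A.tamagawaProduct = 2 :=
  (IntModelTam.tamagawaProduct_eq_rowValueZ_of_intModel hA rowCheckZ_p256d1 (by decide +kernel)).trans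
    (by decide +kernel)

/-- Hence `3 ∤ ∏_ℓ c_ℓ (256d1)`. [cite: Silverman1994, IV.9.4] [cite: Cremona2006, Table 1 (Cremona label 256d1)] -/
theorem not_three_dvd_tamagawaProduct_p256d1 {A : WeierstrassCurve ℚ} [A.IsGloballyMinimal]
    (hA : integralModelInt A = ⟨0, -1, 0, -3, -1⟩) : ¬ 3 ∣ A.tamagawaProduct := by
  rw [tamagawaProduct_p256d1 hA]; decide

/-! ### Reading `GoodOrd W 3` off a literal integer model -/

/-- `3 ∤ Δ` and `#W̃(𝔽₃) = n₃` with `3 ∤ 4 − n₃` (`a₃ = 4 − n₃`) for the integral model of a globally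
minimal `W` give `GoodOrd W 3` (good ORDINARY reduction at `3`). [folklore] -/
theorem goodOrd_three_of_ainvs (a1 a2 a3 a4 a6 : ℤ) {W : WeierstrassCurve ℚ} [W.IsElliptic]
    [W.IsGloballyMinimal] (hW : integralModelInt W = ⟨a1, a2, a3, a4, a6⟩) [Fact (Nat.Prime 3)]
    (n3 : ℕ) (h3Δ : ¬ (3 : ℤ) ∣ discOf [a1, a2, a3, a4, a6])
    (hcard3 : Nat.card (((⟨a1, a2, a3, a4, a6⟩ : WeierstrassCurve ℤ).map
      (Int.castRingHom (ZMod 3))).toAffine.Point) = n3)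
    (hord3 : ¬ (3 : ℤ) ∣ (3 : ℤ) + 1 - n3) : GoodOrd W 3 := by
  have hΔ : (⟨a1, a2, a3, a4, a6⟩ : WeierstrassCurve ℤ).Δ = discOf [a1, a2, a3, a4, a6] :=
    intCurve_Δ a1 a2 a3 a4 a6
  refine ⟨hasGoodReductionAtPrime_of_not_dvd W 3 (by rw [minimalDiscriminantInt_eq hW, hΔ]; exact h3Δ),
    ?_⟩
  rw [frobeniusTrace_eq hW hcard3]; exact hord3

/-! ### §1. The UNIT road ⇒ `BSD(E,3)` -/

/-- **`BSD(E,3)` (Miller's `BSDp W 3`) for a cell with trivial `3`-primary arithmetic given by a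
literal integer model**, analytic rank `0` (`hr0`): the unit road's `MazurMainConjecture W 3`
(`mazurMainConjecture_three_of_ainvs_of_trivialArithmetic`, gen 24) fed to the universal rank-`0`
skeleton `Rank1Residual.bsdp_of_mazurMainConjecture_of_analyticRank_eq_zero` (Greenberg LNM 1716
Thm. 4.1 `hGr`, modularity `hmod`, Gross–Zagier–Kolyvagin `hGZK`). Hypotheses = those of the road +
`hmod`, `hGZK`, `hr0`. Per pair; nothing booked. [cite: Kato2004Asterisque, Thm. 17.4 (1) (p. 273)]
[cite: GreenbergLNM1716, Thm. 4.1 (p. 102)] [cite: CastellaEtAl2021, Thm. 5.1.4 (proof, §5.1.3)]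
[cite: Miller2011LMS, Def. 1.1] -/
theorem bsdp_three_of_ainvs_of_trivialArithmetic
    (hkato : ∀ (W : WeierstrassCurve ℚ) [W.IsElliptic] [W.IsGloballyMinimal] (p : ℕ) [Fact p.Prime]
      (κ : ZpExtension ℚ p) (γ : Field.absoluteGaloisGroup ℚ) (N : ℕ) [NeZero N]
      (f : CuspForm (Gamma0 N) 2), kato_divisibility W p (κ := κ) (γ := γ) (f := f))
    (hGr : greenberg_charValue_rankZero) (h5 : realPeriodRat_eq_unit_mul_plusPeriod)
    (h3 : realPeriodRat_eq_unit_mul_plusPeriod_three)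
    (hmod : nonempty_modularParametrizationData)
    (hGZK : rank_eq_analyticRank_of_analyticRank_le_one)
    (a1 a2 a3 a4 a6 : ℤ) {W : WeierstrassCurve ℚ} [W.IsElliptic] [W.IsGloballyMinimal]
    (hW : integralModelInt W = ⟨a1, a2, a3, a4, a6⟩)
    [Fact (Nat.Prime 3)] (ℓ n n3 : ℕ) [Fact ℓ.Prime]
    (h3Δ : ¬ (3 : ℤ) ∣ discOf [a1, a2, a3, a4, a6])
    (hcard3 : Nat.card (((⟨a1, a2, a3, a4, a6⟩ : WeierstrassCurve ℤ).map
      (Int.castRingHom (ZMod 3))).toAffine.Point) = n3)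
    (hord3 : ¬ (3 : ℤ) ∣ (3 : ℤ) + 1 - n3) (hna3 : ¬ 3 ∣ n3)
    (hℓ3 : ℓ ≠ 3) (hℓΔ : ¬ (ℓ : ℤ) ∣ discOf [a1, a2, a3, a4, a6])
    (hcard : Nat.card (((⟨a1, a2, a3, a4, a6⟩ : WeierstrassCurve ℤ).map
      (Int.castRingHom (ZMod ℓ))).toAffine.Point) = n)
    (hnoroot : ∀ t : ℕ, t < 3 → ¬ (3 : ℤ) ∣ (t : ℤ) ^ 2 - ((ℓ : ℤ) + 1 - n) * t + ℓ)
    (htam : ¬ 3 ∣ W.tamagawaProduct)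
    (hL : ∃ q : ℚ, q ≠ 0 ∧ W.entireLFunction 1 / (W.realPeriodRat : ℂ) = (q : ℂ) ∧ padicValRat 3 q = 0)
    (hSel : Nat.card (W.selmerGroupPInfty 3) = 1) (hr0 : W.analyticRank = 0) :
    BSDp W 3 :=
  Rank1Residual.bsdp_of_mazurMainConjecture_of_analyticRank_eq_zero hGr hmod hGZK (by decide)
    (goodOrd_three_of_ainvs a1 a2 a3 a4 a6 hW n3 h3Δ hcard3 hord3) hr0
    (mazurMainConjecture_three_of_ainvs_of_trivialArithmetic hkato hGr h5 h3 a1 a2 a3 a4 a6 hW ℓ n n3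
      h3Δ hcard3 hord3 hna3 hℓ3 hℓΔ hcard hnoroot htam hL hSel)

/-! ### §2. The TRIVIAL-PARTNER road ⇒ `BSD(E,3)` -/

/-- **`BSD(E,3)` for ANY N2 cell of analytic rank `0` congruent mod `3` to a curve with trivial
`3`-primary arithmetic — with NO descent, NO `L`-value and NO Tamagawa datum of the target.** Target
`W` (`[a₁,…,a₆]`, good ordinary at `3`, `E[3]` irreducible by a Frobenius witness, `hr0`); partner `A`
(`[b₁,…,b₆]`, trivial `3`-primary arithmetic: `3 ∤ Δ_A`, ordinary, non-anomalous, `htamA`, `hLA`,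
`hSelA`); certificate C1 (`hC1`); PUBLISHED `hkato`, `hGr`, `h5`, `h3`, `hGV`, `hmod`, `hGZK`. Proof:
the road's `MazurMainConjecture W 3` (`mazurMainConjecture_three_of_ainvs_of_trivialPartner`, gen 24:
x9 gen 5's trivial-arithmetic main conjecture for `A` transported along C1 by Greenberg–Vatsal 2000
Thm. (1.4)) fed to `Rank1Residual.bsdp_of_mazurMainConjecture_of_analyticRank_eq_zero` (Greenberg's
Euler characteristic formula carries `#Ш(E)[3^∞]` and `∏ c_ℓ(E)` together). Per pair; nothing booked.
[cite: GreenbergVatsal2000, Thm. (1.4) (arXiv p. 5)] [cite: Kato2004Asterisque, Thm. 17.4 (1) (p. 273)]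
[cite: GreenbergLNM1716, Thm. 4.1 (p. 102)] [cite: CastellaEtAl2021, Thm. 5.1.4 (proof, §5.1.3)]
[cite: Miller2011LMS, Def. 1.1] -/
theorem bsdp_three_of_ainvs_of_trivialPartner_rankZero
    (hkato : ∀ (W : WeierstrassCurve ℚ) [W.IsElliptic] [W.IsGloballyMinimal] (p : ℕ) [Fact p.Prime]
      (κ : ZpExtension ℚ p) (γ : Field.absoluteGaloisGroup ℚ) (N : ℕ) [NeZero N]
      (f : CuspForm (Gamma0 N) 2), kato_divisibility W p (κ := κ) (γ := γ) (f := f))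
    (hGr : greenberg_charValue_rankZero) (h5 : realPeriodRat_eq_unit_mul_plusPeriod)
    (h3 : realPeriodRat_eq_unit_mul_plusPeriod_three)
    (hGV : GreenbergVatsal2000.thm14_mainConjecture_transfer_of_torsionIso)
    (hmod : nonempty_modularParametrizationData)
    (hGZK : rank_eq_analyticRank_of_analyticRank_le_one)
    (a1 a2 a3 a4 a6 : ℤ) {W : WeierstrassCurve ℚ} [W.IsElliptic] [W.IsGloballyMinimal]
    (hW : integralModelInt W = ⟨a1, a2, a3, a4, a6⟩)
    (b1 b2 b3 b4 b6 : ℤ) {A : WeierstrassCurve ℚ} [A.IsElliptic] [A.IsGloballyMinimal]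
    (hA : integralModelInt A = ⟨b1, b2, b3, b4, b6⟩)
    [Fact (Nat.Prime 3)] (ℓ n n3 m3 : ℕ) [Fact ℓ.Prime]
    (h3Δ : ¬ (3 : ℤ) ∣ discOf [a1, a2, a3, a4, a6])
    (hcard3 : Nat.card (((⟨a1, a2, a3, a4, a6⟩ : WeierstrassCurve ℤ).map
      (Int.castRingHom (ZMod 3))).toAffine.Point) = n3)
    (hord3 : ¬ (3 : ℤ) ∣ (3 : ℤ) + 1 - n3)
    (hℓ3 : ℓ ≠ 3) (hℓΔ : ¬ (ℓ : ℤ) ∣ discOf [a1, a2, a3, a4, a6])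
    (hcard : Nat.card (((⟨a1, a2, a3, a4, a6⟩ : WeierstrassCurve ℤ).map
      (Int.castRingHom (ZMod ℓ))).toAffine.Point) = n)
    (hnoroot : ∀ t : ℕ, t < 3 → ¬ (3 : ℤ) ∣ (t : ℤ) ^ 2 - ((ℓ : ℤ) + 1 - n) * t + ℓ)
    (h3ΔA : ¬ (3 : ℤ) ∣ discOf [b1, b2, b3, b4, b6])
    (hcard3A : Nat.card (((⟨b1, b2, b3, b4, b6⟩ : WeierstrassCurve ℤ).map
      (Int.castRingHom (ZMod 3))).toAffine.Point) = m3)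
    (hord3A : ¬ (3 : ℤ) ∣ (3 : ℤ) + 1 - m3) (hna3A : ¬ 3 ∣ m3)
    (htamA : ¬ 3 ∣ A.tamagawaProduct)
    (hLA : ∃ q : ℚ, q ≠ 0 ∧ A.entireLFunction 1 / (A.realPeriodRat : ℂ) = (q : ℂ) ∧ padicValRat 3 q = 0)
    (hSelA : Nat.card (A.selmerGroupPInfty 3) = 1)
    (hC1 : ∃ e : geomTorsion A ((3 : ℕ) : ℤ) ≃+ geomTorsion W ((3 : ℕ) : ℤ),
      ∀ (σ : Field.absoluteGaloisGroup ℚ) (P : geomTorsion A ((3 : ℕ) : ℤ)), e (σ • P) = σ • e P)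
    (hr0 : W.analyticRank = 0) :
    BSDp W 3 :=
  Rank1Residual.bsdp_of_mazurMainConjecture_of_analyticRank_eq_zero hGr hmod hGZK (by decide)
    (goodOrd_three_of_ainvs a1 a2 a3 a4 a6 hW n3 h3Δ hcard3 hord3) hr0
    (mazurMainConjecture_three_of_ainvs_of_trivialPartner hkato hGr h5 h3 hGV a1 a2 a3 a4 a6 hW
      b1 b2 b3 b4 b6 hA ℓ n n3 m3 h3Δ hcard3 hord3 hℓ3 hℓΔ hcard hnoroot h3ΔA hcard3A hord3A hna3A
      htamA hLA hSelA hC1)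

/-- **`BSD(E,3)` for ANY N2 cell of analytic rank `1` congruent mod `3` to a curve with trivial
`3`-primary arithmetic, MODULO the Schneider certificate.** Hypotheses as in
`bsdp_three_of_ainvs_of_trivialPartner_rankZero` with `hr1 : r_an(W) = 1` in place of `hr0`, plus the
PUBLISHED odd-prime rank-one facts `hS` (Perrin-Riou–Schneider leading terms,
`Schneider1985_order_charGenerator_odd`), `hPR` (Perrin-Riou 1987 §1.4, `perrinRiou_rankOne_leadingTerms_odd`),
`hMT` (Mazur–Tate `σ`, `mazur_tate_sigma_exists_odd`) and the per-curve CERTIFICATE `hSch`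
(non-degeneracy of THE canonical cyclotomic `3`-adic height — open in general; a `3`-adic
computation per curve, displayed not discharged). Proof: the road's `MazurMainConjecture W 3` fed to
`Rank1Residual.bsdp_of_mazurMainConjecture_of_analyticRank_eq_one_of_schneider_odd`. Per pair;
nothing booked. [cite: GreenbergVatsal2000, Thm. (1.4) (arXiv p. 5)] [cite: Kato2004Asterisque, Thm. 17.4 (1) (p. 273)]
[cite: PerrinRiou1987, §1.4 Cor. 1.8] [cite: BalakrishnanMullerStein2015, Thm. 1.7]
[cite: MazurTate1991, Thm. 3.1] [cite: Miller2011LMS, Def. 1.1] -/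
theorem bsdp_three_of_ainvs_of_trivialPartner_rankOne_of_schneider
    (hkato : ∀ (W : WeierstrassCurve ℚ) [W.IsElliptic] [W.IsGloballyMinimal] (p : ℕ) [Fact p.Prime]
      (κ : ZpExtension ℚ p) (γ : Field.absoluteGaloisGroup ℚ) (N : ℕ) [NeZero N]
      (f : CuspForm (Gamma0 N) 2), kato_divisibility W p (κ := κ) (γ := γ) (f := f))
    (hGr : greenberg_charValue_rankZero) (h5 : realPeriodRat_eq_unit_mul_plusPeriod)
    (h3 : realPeriodRat_eq_unit_mul_plusPeriod_three)
    (hGV : GreenbergVatsal2000.thm14_mainConjecture_transfer_of_torsionIso)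
    (hS : Schneider1985_order_charGenerator_odd) (hPR : perrinRiou_rankOne_leadingTerms_odd)
    (hMT : mazur_tate_sigma_exists_odd) (hmod : nonempty_modularParametrizationData)
    (hGZK : rank_eq_analyticRank_of_analyticRank_le_one)
    (a1 a2 a3 a4 a6 : ℤ) {W : WeierstrassCurve ℚ} [W.IsElliptic] [W.IsGloballyMinimal]
    (hW : integralModelInt W = ⟨a1, a2, a3, a4, a6⟩)
    (b1 b2 b3 b4 b6 : ℤ) {A : WeierstrassCurve ℚ} [A.IsElliptic] [A.IsGloballyMinimal]
    (hA : integralModelInt A = ⟨b1, b2, b3, b4, b6⟩)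
    [Fact (Nat.Prime 3)] (ℓ n n3 m3 : ℕ) [Fact ℓ.Prime]
    (h3Δ : ¬ (3 : ℤ) ∣ discOf [a1, a2, a3, a4, a6])
    (hcard3 : Nat.card (((⟨a1, a2, a3, a4, a6⟩ : WeierstrassCurve ℤ).map
      (Int.castRingHom (ZMod 3))).toAffine.Point) = n3)
    (hord3 : ¬ (3 : ℤ) ∣ (3 : ℤ) + 1 - n3)
    (hℓ3 : ℓ ≠ 3) (hℓΔ : ¬ (ℓ : ℤ) ∣ discOf [a1, a2, a3, a4, a6])
    (hcard : Nat.card (((⟨a1, a2, a3, a4, a6⟩ : WeierstrassCurve ℤ).map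
      (Int.castRingHom (ZMod ℓ))).toAffine.Point) = n)
    (hnoroot : ∀ t : ℕ, t < 3 → ¬ (3 : ℤ) ∣ (t : ℤ) ^ 2 - ((ℓ : ℤ) + 1 - n) * t + ℓ)
    (h3ΔA : ¬ (3 : ℤ) ∣ discOf [b1, b2, b3, b4, b6])
    (hcard3A : Nat.card (((⟨b1, b2, b3, b4, b6⟩ : WeierstrassCurve ℤ).map
      (Int.castRingHom (ZMod 3))).toAffine.Point) = m3)
    (hord3A : ¬ (3 : ℤ) ∣ (3 : ℤ) + 1 - m3) (hna3A : ¬ 3 ∣ m3)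
    (htamA : ¬ 3 ∣ A.tamagawaProduct)
    (hLA : ∃ q : ℚ, q ≠ 0 ∧ A.entireLFunction 1 / (A.realPeriodRat : ℂ) = (q : ℂ) ∧ padicValRat 3 q = 0)
    (hSelA : Nat.card (A.selmerGroupPInfty 3) = 1)
    (hC1 : ∃ e : geomTorsion A ((3 : ℕ) : ℤ) ≃+ geomTorsion W ((3 : ℕ) : ℤ),
      ∀ (σ : Field.absoluteGaloisGroup ℚ) (P : geomTorsion A ((3 : ℕ) : ℤ)), e (σ • P) = σ • e P)
    (hr1 : W.analyticRank = 1)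
    (hSch : ∀ Dh : PAdicHeightData W 3, Dh.IsCanonical → SchneiderConjecture Dh) :
    BSDp W 3 :=
  Rank1Residual.bsdp_of_mazurMainConjecture_of_analyticRank_eq_one_of_schneider_odd hS hPR hMT hmod
    hGZK (by decide) (goodOrd_three_of_ainvs a1 a2 a3 a4 a6 hW n3 h3Δ hcard3 hord3) hr1 hSch
    (mazurMainConjecture_three_of_ainvs_of_trivialPartner hkato hGr h5 h3 hGV a1 a2 a3 a4 a6 hW
      b1 b2 b3 b4 b6 hA ℓ n n3 m3 h3Δ hcard3 hord3 hℓ3 hℓΔ hcard hnoroot h3ΔA hcard3A hord3A hna3A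
      htamA hLA hSelA hC1)

end Summit.BirchSwinnertonDyer.Rank1Residual.X10.UnitRoad

end
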